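import Summits.NavierStokesRegularity.NavierStokesRegularity.Theses.ExtremiserTransience
import Summits.NavierStokesRegularity.NavierStokesRegularity.Theorems.ExtremiserTransienceSliceConstantSpeed
import Summits.NavierStokesRegularity.NavierStokesRegularity.Theorems.ExtremiserTransienceBallMassLower
import HarnessLib

/-!
# Route `ExtremiserTransience`, LINE g5-α repair (seat ns-idea-5 g5): item 27823 `PlateauSliceRigidity` REDUCED TO THE LOCAL ENERGY BUDGET

`--supports stmt-NavierStokesRegularity-27823`.  With stub 1 (`sliceConstantSpeed`, p635764) and stub 3 (`ballMassLower`) of the skeleton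
`PlateauSliceRigidity_birth.lean` landed, the composition below shows — kernel-checked against the route file — that the support item
`PlateauSliceRigidity` (27823) follows from ONE remaining lemma, stated here as the explicit hypothesis `hB`:

> **local energy budget.** A continuous, Oseen-mild (from every `s < t < 0`, `ν = 1`), Type-I-decaying (`√(−t)‖W‖ ≤ K`) ancient field satisfies
> `∫_{B(0,ρ)} ‖W(t₀)‖² ≤ C ρ²` for all `ρ ≥ 1` at each `t₀ < 0`, with `C = C(W, K, t₀)` independent of `ρ`.

(Proof route for `hB`, for its prover — critic idea-crit-4 12:38Z concurring: local energy inequality on `B_ρ × (σ₀, t₀)` with cutoff; initial term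
`K²ρ³/(−σ₀) → 0` as `σ₀ → −∞`; cubic and pressure fluxes `≲ K³ρ²(−σ)^{−3/2}` (Riesz pressure in BMO with the ball mean removed, which needs `div W = 0` —
derived from the class by letting `s → −∞` in the mild identity); viscous flux in the ONCE-integrated gradient form `≲ K K′ ρ² (−σ)^{−3/2}` with the mild
gradient decay `|∇W(σ)| ≤ K′/(−σ)` — the twice-integrated `Δφ` form diverges logarithmically; `∫_{−∞}^{t₀} (−σ)^{−3/2} dσ = 2/√(−t₀)`.)
So after this file LINE α's open content is exactly: 27676 `LocalNearPlateauStability` (X), 27822 `PlateauSliceTransfer` (its stub S3 landed as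
`plateauPersistence`, p635455), and the budget `hB`.  HONEST FRAMING: a reduction between statements about hypothetical ancient fields; nothing about
Navier–Stokes regularity is proved and no summit is proved by a line. [folklore]
-/

namespace Summit.NavierStokesRegularity.NavierStokesRegularity.Theses.ExtremiserTransience
set_option linter.dupNamespace false

open MeasureTheory

/-- **27823 from the local energy budget**: `PlateauSliceRigidity` follows from the budget `hB` via the landed stubs `sliceConstantSpeed`
(analytic slice + Mityagin ⇒ constant speed) and `ballMassLower` (`m²|B₁|ρ³ ≤ ∫_{B_ρ}‖W t₀‖²`): `c ρ³ ≤ C ρ²` fails for large `ρ`. [folklore] -/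
theorem plateauSliceRigidity_of_budget
    (hB : ∀ (W : ℝ → EuclideanSpace ℝ (Fin 3) → EuclideanSpace ℝ (Fin 3)) (K t₀ : ℝ),
      ContinuousOn (Function.uncurry W) (Set.Iio (0 : ℝ) ×ˢ Set.univ) →
      (∀ s t : ℝ, s < t → t < 0 → ∀ x, W t x =
        Literature.Analysis.FluidPDE.heatFlow (W s) (t - s) x - Literature.Analysis.FluidPDE.oseenDuhamel 1 s W W t x) →
      (∀ t : ℝ, t < 0 → ∀ x, Real.sqrt (-t) * ‖W t x‖ ≤ K) → t₀ < 0 →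
      ∃ C : ℝ, ∀ ρ : ℝ, 1 ≤ ρ → ∫ y in Metric.ball (0 : EuclideanSpace ℝ (Fin 3)) ρ, ‖W t₀ y‖ ^ 2 ≤ C * ρ ^ 2) :
    PlateauSliceRigidity := by
  rintro ⟨W, K, t₀, m, hcont, hmild, hdec, ht0, hm, hle, hvol⟩
  have hconst := Theorems.ExtremiserTransience.sliceConstantSpeed W K t₀ m hcont hmild hdec ht0 hm hle hvol
  obtain ⟨C, hC⟩ := hB W K t₀ hcont hmild hdec ht0
  obtain ⟨c, hc, hcρ⟩ := Theorems.ExtremiserTransience.ballMassLower W t₀ m hm hconst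
  set ρ : ℝ := max 1 (C / c + 1) with hρ
  have hρ1 : 1 ≤ ρ := le_max_left _ _
  have hρpos : 0 < ρ := lt_of_lt_of_le one_pos hρ1
  have h1 : c * ρ ^ 3 ≤ C * ρ ^ 2 := (hcρ ρ hρ1).trans (hC ρ hρ1)
  have h2 : c * ρ ≤ C := by
    have hsq : 0 < ρ ^ 2 := by positivity
    have h3 : c * ρ * ρ ^ 2 ≤ C * ρ ^ 2 := by
      calc c * ρ * ρ ^ 2 = c * ρ ^ 3 := by ring
        _ ≤ C * ρ ^ 2 := h1
    exact le_of_mul_le_mul_right h3 hsq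
  have h4 : c * (C / c + 1) ≤ c * ρ := mul_le_mul_of_nonneg_left (le_max_right _ _) hc.le
  have h5 : c * (C / c + 1) = C + c := by
    field_simp
  linarith

end Summit.NavierStokesRegularity.NavierStokesRegularity.Theses.ExtremiserTransience
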